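import Summits.Langlands.Langlands.Theses.AbelianSurfaceSerre
import Literature.NumberTheory.DiophantineGeometry.BcgpSerreReductionEndTrivialSurfaces
import HarnessLib

/-!
# `AbelianSurfaceSerre.BCGPSerreReduction` BY NAME: kernel calibration against the vended fact,
# conditional closure, and the pure-logic reduction modulo K2
# (item stmt-Langlands-17768, support, rank 9; `--supports`, conditional-result)

The route decl `Summit.Langlands.Langlands.Theses.AbelianSurfaceSerre.BCGPSerreReduction`
(`SerreGSp4Surjective → QuadraticImprimitiveSurfaces → EndTrivialSurfacesModular`, the printed
reduction "Serre for `GSp₄` in regular ordinary weight at the surjective residues ⟹ every abelian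
surface `A/ℚ` with `End_ℚ(A) = ℤ` is modular", Boxer–Calegari–Gee–Pilloni 2025, arXiv:2502.20645,
Lemma 10.4.1 with Remark 10.4.2 and its proof p. 146, Theorem 10.2.1, Remark 10.2.2,
Definition 1.8.12) is, binder for binder, the tree's named fact
`Literature.NumberTheory.DiophantineGeometry.bcgp_serreSurjective_quadraticImprimitive_implies_endTrivialSurfacesModular`
(file `Literature/NumberTheory/DiophantineGeometry/BcgpSerreReductionEndTrivialSurfaces.lean`,
vended for this route's cite item).

This module records that identity in the kernel (`route_iff_bcgp`, `Iff.rfl`: the vended fact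
neither loses nor gains strength against the item), states the closure AGAINST THE ROUTE DECL BY
NAME conditionally on the named fact (`BCGPSerreReduction_of_bcgp`, a `conditional-result`: the
item closes unconditionally only with a discharge
`bcgp_serreSurjective_quadraticImprimitive_implies_endTrivialSurfacesModular_holds`, i.e. the
whole of BCGP 2021/2025 — higher Hida theory, ordinary `R = T` for `GSp₄`, multiplicity one and
classicality, Arthur's transfer — absent from the tree), and proves the one piece of the item that
IS pure logic: the second crux `QuadraticImprimitiveSurfaces` enters only through the case split
"is `r|Γ_K` reducible for some quadratic `K`?", so that the item is EQUIVALENT to the `K2`-guarded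
statement whose conclusion is restricted to the quadratically PRIMITIVE surfaces
(`BCGPSerreReduction_iff_primitive`) — exactly the surfaces the printed proof treats by
Lemma 10.4.1 (Galois type **A**) and Theorem 10.2.1 (the remaining non-challenging types), which is
therefore the residual content a discharge of the fact has to supply.

This file imports the Theses file and is NOT to be imported by a module that closes an item of
this route by name (the gate's `_holds` link would cycle).

References: G. Boxer, F. Calegari, T. Gee, V. Pilloni, *Modularity theorems for abelian
surfaces*, arXiv:2502.20645, §10.2 (Thm. 10.2.1, Rem. 10.2.2, p. 138–139), §10.4 (Lemma 10.4.1,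
Rem. 10.4.2, proof p. 146), Def. 1.8.12 [BoxerCalegariGeePilloni2025]; T. Gee, ICM 2026 survey,
arXiv:2510.02756, §6.
-/


set_option linter.dupNamespace false -- project-wide option (lakefile weak.linter.dupNamespace); `Summit.Langlands.Langlands` is the mandated namespace

namespace Summit.Langlands.Langlands.Theorems.BCGPSerreReduction

open Summit.Langlands.Langlands.Theses.AbelianSurfaceSerre
open Literature.NumberTheory.DiophantineGeometry

/-- The route decl `AbelianSurfaceSerre.BCGPSerreReduction` is, definitionally, the named fact
`bcgp_serreSurjective_quadraticImprimitive_implies_endTrivialSurfacesModular` (BCGP 2025,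
Lemma 10.4.1 with Rem. 10.4.2 along its proof p. 146, Thm. 10.2.1, Def. 1.8.12, typed for this
route): the three brackets of the fact are verbatim the bodies of `SerreGSp4Surjective`,
`QuadraticImprimitiveSurfaces` and `EndTrivialSurfacesModular`.
[cite: BoxerCalegariGeePilloni2025, Lemma 10.4.1, Rem. 10.4.2, proof p. 146; Thm. 10.2.1; Def. 1.8.12] -/
theorem route_iff_bcgp :
    Summit.Langlands.Langlands.Theses.AbelianSurfaceSerre.BCGPSerreReduction ↔
      bcgp_serreSurjective_quadraticImprimitive_implies_endTrivialSurfacesModular :=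
  Iff.rfl

/-- **Conditional closure by name** (`conditional-result`): the named fact
`bcgp_serreSurjective_quadraticImprimitive_implies_endTrivialSurfacesModular` (BCGP 2025,
Lemma 10.4.1 + Rem. 10.4.2 + Thm. 10.2.1 in consumed form) gives the route decl
`AbelianSurfaceSerre.BCGPSerreReduction`. The item closes unconditionally only with
`bcgp_serreSurjective_quadraticImprimitive_implies_endTrivialSurfacesModular_holds`.
[cite: BoxerCalegariGeePilloni2025, Lemma 10.4.1, Rem. 10.4.2, Thm. 10.2.1] -/
theorem BCGPSerreReduction_of_bcgp
    (h : bcgp_serreSurjective_quadraticImprimitive_implies_endTrivialSurfacesModular) :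
    Summit.Langlands.Langlands.Theses.AbelianSurfaceSerre.BCGPSerreReduction :=
  h

/-- **Reduction modulo K2 (pure logic).** The item `BCGPSerreReduction` is equivalent to the
`K2`-guarded implication whose conclusion is `EndTrivialSurfacesModular` RESTRICTED to the
quadratically primitive surfaces (`r|Γ_K` irreducible for every quadratic number field `K`): the
crux `QuadraticImprimitiveSurfaces` covers, by the case split on
`∃ K quadratic, ¬ IsIrreducible (r.restrictField K)`, every other surface with `End_ℚ(A) = ℤ`
(Galois types **B**[C₂] ⊂ quadratically imprimitive, BCGP 2025 p. 138 and Rem. 10.2.2), so the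
Serre hypothesis `SerreGSp4Surjective` is needed only for the primitive ones (type **A** by the
proof of Lemma 10.4.1, p. 146; the rest by Thm. 10.2.1).
[cite: BoxerCalegariGeePilloni2025, Thm. 10.2.1, Rem. 10.2.2 (p. 138–139); Lemma 10.4.1, proof p. 146] -/
theorem BCGPSerreReduction_iff_primitive :
    Summit.Langlands.Langlands.Theses.AbelianSurfaceSerre.BCGPSerreReduction ↔
      (SerreGSp4Surjective → QuadraticImprimitiveSurfaces →
        ∀ (A : Literature.AlgebraicGeometry.Motives.AbelianVariety ℚ), A.dim = 2 →
          (∀ f : A ⟶ A, ∃ n : ℤ, f = n • CategoryTheory.CategoryStruct.id A) →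
          ∀ (p : ℕ) [Fact p.Prime] (b : Module.Basis (Fin 4) ℚ_[p] (A.rationalTateModule p))
            (r : Literature.NumberTheory.GaloisRepresentations.FramedGaloisRep ℚ (PadicAlgCl p) 4),
            (∀ g : Field.absoluteGaloisGroup ℚ, (r g).val =
              ((LinearMap.toMatrix b b (A.rationalTateRep p g⁻¹)).map
                (algebraMap ℚ_[p] (PadicAlgCl p))).transpose) →
            (∀ (K : Type) [Field K] [NumberField K], Module.finrank ℚ K = 2 →
              Literature.NumberTheory.GaloisRepresentations.FramedRep.IsIrreducible
                (r.restrictField K)) →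
            ∀ (hcpt : Literature.NumberTheory.Automorphic.isCompact_glFiniteIntegralLevel 4 ℚ)
              (ι : PadicAlgCl p ≃+* ℂ),
              ∃ π : Literature.NumberTheory.Automorphic.CuspidalAutomorphicRepData 4 ℚ hcpt,
                π.1.IsLAlgebraic ∧
                  ∀ᶠ v : IsDedekindDomain.HeightOneSpectrum (NumberField.RingOfIntegers ℚ) in
                    Filter.cofinite, ∃ a : Multiset ℂ, π.1.HasSatakeParamAt v a ∧
                      r.IsUnramifiedAt v ∧ r.HasFrobCharpolyAt v
                        (Literature.NumberTheory.Automorphic.arithFrobPolyOfSatake ι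
                          v.residueCard 1 a)) := by
  constructor
  · intro h h₁ h₂ A hA hEnd p _ b r hr _ hcpt ι
    exact h h₁ h₂ A hA hEnd p b r hr hcpt ι
  · intro h h₁ h₂ A hA hEnd p _ b r hr hcpt ι
    by_cases hq : ∃ (K : Type) (_ : Field K) (_ : NumberField K), Module.finrank ℚ K = 2 ∧
        ¬ Literature.NumberTheory.GaloisRepresentations.FramedRep.IsIrreducible (r.restrictField K)
    · exact h₂ A hA hEnd p b r hr hq hcpt ι
    · refine h h₁ h₂ A hA hEnd p b r hr (fun K _ _ hK => ?_) hcpt ι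
      by_contra hirr
      exact hq ⟨K, inferInstance, inferInstance, hK, hirr⟩

end Summit.Langlands.Langlands.Theorems.BCGPSerreReduction
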